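import Summits.CriticalPhenomena.PercolationContinuityZ3.Theorems.FK.MagnetizationChernoffBounds
import HarnessLib

/-!
# LARGE DEVIATIONS OF THE MAGNETISATION ON `ℤ^d`: THE UPPER BOUND WITH RATE `βsm − (ψ(β,h+s) − ψ(β,h))` AND
# EXPONENTIAL CONCENTRATION OF `M_Λ/|Λ|` FROM THE ONE-SIDED FIELD-DERIVATIVES OF THE PRESSURE
# (Ellis 2006, Thms. II.6.1 (b), II.6.3, IV.5.5, V.6.1 (c); Lanford 1973)

Claimed R42 (8)(c) in the cell INBOX at 2026-08-29T07:20:29Z by fkp-10a gen 359 (NEW CLAIM #1 of the gen), addressed to the lane under (ι) (coordinator fk-4 gen 293 CLOSED l.8789 06:52:14Z 2026-08-29; «(ι) RESUMES») and to the next seated fk-4 generation (ruling R172 requested); lineage row FO-10a-g359 (self-suggested), package g359-largedev, label LD-B.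
Helper file of the `fk-continuity` build cell (bschramm lane; `--supports stmt-CriticalPhenomena-4575`); builds on
p205010 (kernel theorem, internal audit signed; external expert review pending). No definitions, no named facts, no
sorries; standard axioms. UNCONDITIONAL (nearest-neighbour Ising model on `ℤ^d`, boxes `Λ_N = {−N,…,N}^d`, EVERY
boundary condition `bc`; `μ_N = μ^{bc}_{Λ_N;β,h}`, `M_N = Σ_{x∈Λ_N} σ_x`, `ψ(β,h) = pressure d β h`).

Ellis (2006), Thm. IV.5.5 / §V.6–V.7: the free energy function of the total spin under the finite-volume Gibbs
states is `c_{β,h}(t) = lim |Λ|⁻¹ log ⟨e^{t S_Λ}⟩_{Λ,β,h}`, equal (eq. (4.33), our sign convention, `t = βs`) to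
`ψ(β,h+s) − ψ(β,h)`; Thm. II.6.1 (b) gives the large-deviation upper bound with the Legendre transform of `c`,
and Thm. II.6.3 the exponential convergence `S_Λ/|Λ| →exp m` exactly when `c` is differentiable at `0`, i.e. when
`∂ψ/∂h` exists. This file proves the finite-volume-Gibbs-state versions on `ℤ^d`, for every boundary condition:

* `tendsto_pressureIn_sub`, **`tendsto_cgf_sum_spinAt_div_card`** — (4.33): `|Λ_N|⁻¹ cgf_{M_N}(βs) → ψ(β,h+s) − ψ(β,h)`;
* **`eventually_measureReal_le_sum_spinAt_le`** — THE UPPER LARGE-DEVIATION BOUND FOR HALF-LINES: for `βs ≥ 0`,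
  every `m`, `ε > 0`, eventually `μ_N{m|Λ_N| ≤ M_N} ≤ exp(−|Λ_N| (βsm − (ψ(β,h+s) − ψ(β,h)) − ε))`, and the lower
  half-line twin `eventually_measureReal_sum_spinAt_le_le` (rate `−βsm − (ψ(β,h−s) − ψ(β,h))`); optimising over
  `s ≥ 0` these are Ellis' bounds `limsup |Λ|⁻¹ log Q_Λ[m,∞) ≤ −I(m)` with `I` the Legendre transform of `c_{β,h}`;
* `exp_decay_upper_of_rate_pos` / `exp_decay_lower_of_rate_pos` — a positive rate at one `s` gives
  `μ_N{m|Λ_N| ≤ M_N} ≤ e^{−c|Λ_N|}` eventually, for every boundary condition, with one `c > 0`;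
* `exists_rate_pos_of_hasDerivWithinAt_Ici` / `_Iic` — if `∂⁺ψ/∂h(β,h) < βm` (resp. `βm < ∂⁻ψ/∂h(β,h)`) some rate
  is positive (the right/left slopes converge to the one-sided derivative);
* **`upper_tail_exp_decay_of_hasDerivWithinAt`**, **`lower_tail_exp_decay_of_hasDerivWithinAt`**,
  **`exp_concentration_of_hasDerivAt`** — EXPONENTIAL CONCENTRATION OF `M_N/|Λ_N|` below `∂⁺ψ/∂h /β`, above
  `∂⁻ψ/∂h /β`, and AT `ψ'(h)/β` when `ψ(β,·)` is differentiable at `h` (Ellis Thm. II.6.3 (b) ⇒ (a), Thm. IV.5.5 ⇐);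
* the Ising specialisations (`∂^±ψ/∂h = ±β m*(β)` at `h = 0`, `β m(β,h)` at `h > 0`) are in the sequel
  `MagnetizationExponentialLLN`.

## References

* R. S. Ellis, *Entropy, Large Deviations, and Statistical Mechanics*, Springer (1985/2006), Thm. II.6.1, (2.31),
  Thm. II.6.3, §IV.5 Thm. IV.5.5 and eqs. (4.32)–(4.34), §V.6 Thm. V.6.1 (c)–(d) and the remark after it, §V.7
  eq. (5.26), Note 13 to Ch. IV. [Ellis2006]
* O. E. Lanford, *Entropy and equilibrium states in classical statistical mechanics*, LNP 20, Springer (1973),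
  1–113. [Lanford1973]
* S. Friedli, Y. Velenik, *Statistical Mechanics of Lattice Systems*, CUP (2017), Thm. 3.6, Prop. 3.29,
  Thm. 3.43 / Cor. 3.44. [FriedliVelenik2017]
-/

noncomputable section

namespace Summit.CriticalPhenomena.PercolationContinuityZ3.Theorems.FK

namespace IsingLargeDeviations

open MeasureTheory ProbabilityTheory Filter Topology Finset Set
open Literature.Probability.LatticeModels

variable {d : ℕ}

/-! ### The free energy function of the total spin: `|Λ_N|⁻¹ cgf_{M_N}(βs) → ψ(β,h+s) − ψ(β,h)` -/

/-- `ψ^{bc}_{Λ_N}(β,h+s) − ψ^{bc}_{Λ_N}(β,h) → ψ(β,h+s) − ψ(β,h)` (every boundary condition; Friedli–Velenik Thm. 3.6).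
[cite: FriedliVelenik2017, Thm. 3.6] -/
theorem tendsto_pressureIn_sub (β h s : ℝ) (bc : BoundaryCondition (Site d)) :
    Tendsto (fun N : ℕ => pressureIn (zdGraph d) (box d N) β (h + s) bc - pressureIn (zdGraph d) (box d N) β h bc)
      atTop (𝓝 (pressure d β (h + s) - pressure d β h)) :=
  (hasBoxLimit_pressureIn_holds (d := d) β (h + s) bc).sub (hasBoxLimit_pressureIn_holds (d := d) β h bc)

/-- **ELLIS (4.33) ON `ℤ^d`: `|Λ_N|⁻¹ cgf_{M_N}(βs) → ψ(β,h+s) − ψ(β,h)`** under `μ^{bc}_{Λ_N;β,h}`, every boundary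
condition — the free energy function of the total spin is a difference of pressures. [cite: Ellis2006, §IV.5 eq. (4.33) and §V.7 eq. (5.26)] -/
theorem tendsto_cgf_sum_spinAt_div_card (β h s : ℝ) (bc : BoundaryCondition (Site d)) :
    Tendsto (fun N : ℕ => cgf (fun σ : SpinConfig (Site d) => ∑ x ∈ box d N, spinAt x σ)
        (isingMeasure (zdGraph d) (box d N) β h bc) (β * s) / #(box d N))
      atTop (𝓝 (pressure d β (h + s) - pressure d β h)) := by
  refine (tendsto_pressureIn_sub (d := d) β h s bc).congr fun N => ?_
  have hpos : (0 : ℝ) < #(box d N) := by exact_mod_cast (box_nonempty d N).card_pos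
  rw [cgf_sum_spinAt_eq_card_mul (zdGraph d) (box_nonempty d N), mul_div_cancel_left₀ _ hpos.ne']

/-! ### The large-deviation upper bound for half-lines -/

/-- **THE UPPER LARGE-DEVIATION BOUND, UPPER HALF-LINE**: for `βs ≥ 0`, every `m`, every `ε > 0` and every boundary
condition, eventually `μ^{bc}_{Λ_N;β,h}{m|Λ_N| ≤ M_N} ≤ exp(−|Λ_N| (βsm − (ψ(β,h+s) − ψ(β,h)) − ε))`.
[cite: Ellis2006, Thm. II.6.1 (b) with §IV.5 eq. (4.33)] -/
theorem eventually_measureReal_le_sum_spinAt_le {β s : ℝ} (hβs : 0 ≤ β * s) (h : ℝ)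
    (bc : BoundaryCondition (Site d)) (m : ℝ) {ε : ℝ} (hε : 0 < ε) :
    ∀ᶠ N : ℕ in atTop,
      (isingMeasure (zdGraph d) (box d N) β h bc).real {σ | m * #(box d N) ≤ ∑ x ∈ box d N, spinAt x σ} ≤
        Real.exp (-(#(box d N) * (β * s * m - (pressure d β (h + s) - pressure d β h) - ε))) := by
  have hev : ∀ᶠ N : ℕ in atTop, pressureIn (zdGraph d) (box d N) β (h + s) bc - pressureIn (zdGraph d) (box d N) β h bc
      < pressure d β (h + s) - pressure d β h + ε :=
    (tendsto_pressureIn_sub (d := d) β h s bc).eventually (gt_mem_nhds (by linarith))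
  filter_upwards [hev] with N hN
  refine (measureReal_le_sum_spinAt_le_exp_card (zdGraph d) (box_nonempty d N) hβs h bc m).trans ?_
  rw [Real.exp_le_exp]
  have hpos : (0 : ℝ) < #(box d N) := by exact_mod_cast (box_nonempty d N).card_pos
  nlinarith

/-- **THE UPPER LARGE-DEVIATION BOUND, LOWER HALF-LINE**: for `βs ≥ 0`, every `m`, `ε > 0`, `bc`, eventually
`μ^{bc}_{Λ_N;β,h}{M_N ≤ m|Λ_N|} ≤ exp(−|Λ_N| (−βsm − (ψ(β,h−s) − ψ(β,h)) − ε))`.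
[cite: Ellis2006, Thm. II.6.1 (b) with §IV.5 eq. (4.33)] -/
theorem eventually_measureReal_sum_spinAt_le_le {β s : ℝ} (hβs : 0 ≤ β * s) (h : ℝ)
    (bc : BoundaryCondition (Site d)) (m : ℝ) {ε : ℝ} (hε : 0 < ε) :
    ∀ᶠ N : ℕ in atTop,
      (isingMeasure (zdGraph d) (box d N) β h bc).real {σ | ∑ x ∈ box d N, spinAt x σ ≤ m * #(box d N)} ≤
        Real.exp (-(#(box d N) * (-(β * s * m) - (pressure d β (h - s) - pressure d β h) - ε))) := by
  have hlim := tendsto_pressureIn_sub (d := d) β h (-s) bc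
  simp only [← sub_eq_add_neg] at hlim
  have hev : ∀ᶠ N : ℕ in atTop, pressureIn (zdGraph d) (box d N) β (h - s) bc - pressureIn (zdGraph d) (box d N) β h bc
      < pressure d β (h - s) - pressure d β h + ε :=
    hlim.eventually (gt_mem_nhds (by linarith))
  filter_upwards [hev] with N hN
  refine (measureReal_sum_spinAt_le_le_exp_card (zdGraph d) (box_nonempty d N) hβs h bc m).trans ?_
  rw [Real.exp_le_exp]
  have hpos : (0 : ℝ) < #(box d N) := by exact_mod_cast (box_nonempty d N).card_pos
  nlinarith

/-! ### A positive rate gives exponential decay, uniformly labelled by the boundary condition -/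

/-- **A positive rate at one `s ≥ 0` (with `βs ≥ 0`) gives exponential decay of the upper tail**: if
`0 < βsm − (ψ(β,h+s) − ψ(β,h))` then there is `c > 0` such that for EVERY boundary condition, eventually
`μ^{bc}_{Λ_N;β,h}{m|Λ_N| ≤ M_N} ≤ e^{−c|Λ_N|}`. [cite: Ellis2006, Thm. II.6.1 (b) and (2.31)] -/
theorem exp_decay_upper_of_rate_pos {β s : ℝ} (hβs : 0 ≤ β * s) {h m : ℝ}
    (hrate : 0 < β * s * m - (pressure d β (h + s) - pressure d β h)) :
    ∃ c : ℝ, 0 < c ∧ ∀ bc : BoundaryCondition (Site d), ∀ᶠ N : ℕ in atTop,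
      (isingMeasure (zdGraph d) (box d N) β h bc).real {σ | m * #(box d N) ≤ ∑ x ∈ box d N, spinAt x σ} ≤
        Real.exp (-(c * #(box d N))) := by
  set r := β * s * m - (pressure d β (h + s) - pressure d β h) with hr
  refine ⟨r / 2, by linarith, fun bc => ?_⟩
  filter_upwards [eventually_measureReal_le_sum_spinAt_le (d := d) hβs h bc m (half_pos hrate)] with N hN
  refine hN.trans (le_of_eq ?_)
  congr 1
  rw [← hr]
  ring

/-- **A positive rate gives exponential decay of the lower tail**: if `0 < −βsm − (ψ(β,h−s) − ψ(β,h))` (`βs ≥ 0`)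
then for some `c > 0`, every `bc`, eventually `μ^{bc}_{Λ_N;β,h}{M_N ≤ m|Λ_N|} ≤ e^{−c|Λ_N|}`.
[cite: Ellis2006, Thm. II.6.1 (b) and (2.31)] -/
theorem exp_decay_lower_of_rate_pos {β s : ℝ} (hβs : 0 ≤ β * s) {h m : ℝ}
    (hrate : 0 < -(β * s * m) - (pressure d β (h - s) - pressure d β h)) :
    ∃ c : ℝ, 0 < c ∧ ∀ bc : BoundaryCondition (Site d), ∀ᶠ N : ℕ in atTop,
      (isingMeasure (zdGraph d) (box d N) β h bc).real {σ | ∑ x ∈ box d N, spinAt x σ ≤ m * #(box d N)} ≤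
        Real.exp (-(c * #(box d N))) := by
  set r := -(β * s * m) - (pressure d β (h - s) - pressure d β h) with hr
  refine ⟨r / 2, by linarith, fun bc => ?_⟩
  filter_upwards [eventually_measureReal_sum_spinAt_le_le (d := d) hβs h bc m (half_pos hrate)] with N hN
  refine hN.trans (le_of_eq ?_)
  congr 1
  rw [← hr]
  ring

/-! ### Positive rates from the one-sided derivatives of `ψ(β,·)` -/

/-- **If `∂⁺ψ/∂h (β,h) = D < βm` then some rate is positive**: `∃ s > 0, 0 < βsm − (ψ(β,h+s) − ψ(β,h))` (the right
slopes `(ψ(h+s) − ψ(h))/s` tend to `D`). [cite: Ellis2006, Thm. II.6.3 (proof, §VII.6)] -/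
theorem exists_rate_pos_of_hasDerivWithinAt_Ici {β h D m : ℝ}
    (hD : HasDerivWithinAt (fun t => pressure d β t) D (Ici h) h) (hm : D < β * m) :
    ∃ s : ℝ, 0 < s ∧ 0 < β * s * m - (pressure d β (h + s) - pressure d β h) := by
  set δ := (β * m - D) / 2 with hδ
  have hδpos : 0 < δ := by rw [hδ]; linarith
  -- slopes from the right converge to `D`
  have hslope : Tendsto (fun t => slope (fun t => pressure d β t) h t) (𝓝[>] h) (𝓝 D) := by
    have := (hasDerivWithinAt_iff_tendsto_slope' (notMem_Ioi.2 le_rfl)).1 (hD.mono Ioi_subset_Ici_self)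
    simpa using this
  have hev : ∀ᶠ t in 𝓝[>] h, slope (fun t => pressure d β t) h t < D + δ :=
    hslope.eventually (gt_mem_nhds (by linarith))
  obtain ⟨t, ht1, ht2⟩ := (hev.and (eventually_mem_nhdsWithin (a := h) (s := Ioi h))).exists
  have hs : 0 < t - h := sub_pos.2 ht2
  refine ⟨t - h, hs, ?_⟩
  rw [slope_def_field] at ht1
  have h1 := (div_lt_iff₀ hs).1 ht1
  rw [add_sub_cancel]
  nlinarith

/-- **If `βm < D = ∂⁻ψ/∂h (β,h)` then some lower rate is positive**: `∃ s > 0, 0 < −βsm − (ψ(β,h−s) − ψ(β,h))`.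
[cite: Ellis2006, Thm. II.6.3 (proof, §VII.6)] -/
theorem exists_rate_pos_of_hasDerivWithinAt_Iic {β h D m : ℝ}
    (hD : HasDerivWithinAt (fun t => pressure d β t) D (Iic h) h) (hm : β * m < D) :
    ∃ s : ℝ, 0 < s ∧ 0 < -(β * s * m) - (pressure d β (h - s) - pressure d β h) := by
  set δ := (D - β * m) / 2 with hδ
  have hδpos : 0 < δ := by rw [hδ]; linarith
  have hslope : Tendsto (fun t => slope (fun t => pressure d β t) h t) (𝓝[<] h) (𝓝 D) := by
    have := (hasDerivWithinAt_iff_tendsto_slope' (notMem_Iio.2 le_rfl)).1 (hD.mono Iio_subset_Iic_self)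
    simpa using this
  have hev : ∀ᶠ t in 𝓝[<] h, D - δ < slope (fun t => pressure d β t) h t :=
    hslope.eventually (lt_mem_nhds (by linarith))
  obtain ⟨t, ht1, ht2⟩ := (hev.and (eventually_mem_nhdsWithin (a := h) (s := Iio h))).exists
  have hs : 0 < h - t := sub_pos.2 ht2
  refine ⟨h - t, hs, ?_⟩
  rw [slope_def_field] at ht1
  have hneg : t - h < 0 := by linarith
  have h1 := (lt_div_iff_of_neg hneg).1 ht1
  rw [sub_sub_cancel]
  nlinarith

/-! ### Exponential concentration from one-sided derivatives (Ellis Thm. II.6.3 (b) ⇒ (a)) -/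

/-- **UPPER TAIL FROM THE RIGHT DERIVATIVE**: if `β ≥ 0` and `∂⁺ψ/∂h (β,h) = D < βm`, then for some `c > 0` and
EVERY boundary condition, eventually `μ^{bc}_{Λ_N;β,h}{m|Λ_N| ≤ M_N} ≤ e^{−c|Λ_N|}`.
[cite: Ellis2006, Thm. II.6.3 and Thm. IV.5.5; Lanford1973] -/
theorem upper_tail_exp_decay_of_hasDerivWithinAt {β : ℝ} (hβ : 0 ≤ β) {h D m : ℝ}
    (hD : HasDerivWithinAt (fun t => pressure d β t) D (Ici h) h) (hm : D < β * m) :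
    ∃ c : ℝ, 0 < c ∧ ∀ bc : BoundaryCondition (Site d), ∀ᶠ N : ℕ in atTop,
      (isingMeasure (zdGraph d) (box d N) β h bc).real {σ | m * #(box d N) ≤ ∑ x ∈ box d N, spinAt x σ} ≤
        Real.exp (-(c * #(box d N))) := by
  obtain ⟨s, hs, hrate⟩ := exists_rate_pos_of_hasDerivWithinAt_Ici (d := d) hD hm
  exact exp_decay_upper_of_rate_pos (mul_nonneg hβ hs.le) hrate

/-- **LOWER TAIL FROM THE LEFT DERIVATIVE**: if `β ≥ 0` and `βm < D = ∂⁻ψ/∂h (β,h)`, then for some `c > 0` and every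
boundary condition, eventually `μ^{bc}_{Λ_N;β,h}{M_N ≤ m|Λ_N|} ≤ e^{−c|Λ_N|}`.
[cite: Ellis2006, Thm. II.6.3 and Thm. IV.5.5; Lanford1973] -/
theorem lower_tail_exp_decay_of_hasDerivWithinAt {β : ℝ} (hβ : 0 ≤ β) {h D m : ℝ}
    (hD : HasDerivWithinAt (fun t => pressure d β t) D (Iic h) h) (hm : β * m < D) :
    ∃ c : ℝ, 0 < c ∧ ∀ bc : BoundaryCondition (Site d), ∀ᶠ N : ℕ in atTop,
      (isingMeasure (zdGraph d) (box d N) β h bc).real {σ | ∑ x ∈ box d N, spinAt x σ ≤ m * #(box d N)} ≤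
        Real.exp (-(c * #(box d N))) := by
  obtain ⟨s, hs, hrate⟩ := exists_rate_pos_of_hasDerivWithinAt_Iic (d := d) hD hm
  exact exp_decay_lower_of_rate_pos (mul_nonneg hβ hs.le) hrate

/-- Two exponentially small sequences add up to an exponentially small one along the boxes of `ℤ^d`, `d ≥ 1`
(`|Λ_N| → ∞` absorbs the factor `2`). [folklore] -/
theorem eventually_exp_add_exp_le (hd : 1 ≤ d) {c₁ c₂ : ℝ} (hc₁ : 0 < c₁) (hc₂ : 0 < c₂) :
    ∀ᶠ N : ℕ in atTop, Real.exp (-(c₁ * #(box d N))) + Real.exp (-(c₂ * #(box d N))) ≤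
      Real.exp (-(min c₁ c₂ / 2 * #(box d N))) := by
  have hc : 0 < min c₁ c₂ := lt_min hc₁ hc₂
  -- `|Λ_N| → ∞`
  have hcard : Tendsto (fun N : ℕ => (#(box d N) : ℝ)) atTop atTop := by
    refine tendsto_atTop_mono (fun N => ?_) tendsto_natCast_atTop_atTop
    have h : N ≤ #(box d N) := by
      rw [card_box]
      exact (show N ≤ 2 * N + 1 by omega).trans (Nat.le_self_pow (by omega) _)
    exact_mod_cast h
  have hsmall : Tendsto (fun N : ℕ => 2 * Real.exp (-(min c₁ c₂ / 2 * #(box d N)))) atTop (𝓝 0) := by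
    have h1 : Tendsto (fun N : ℕ => -(min c₁ c₂ / 2 * (#(box d N) : ℝ))) atTop atBot :=
      tendsto_neg_atTop_atBot.comp (hcard.const_mul_atTop (by positivity))
    simpa using (Real.tendsto_exp_atBot.comp h1).const_mul 2
  have hev : ∀ᶠ N : ℕ in atTop, 2 * Real.exp (-(min c₁ c₂ / 2 * #(box d N))) ≤ 1 :=
    hsmall.eventually (eventually_le_nhds one_pos)
  filter_upwards [hev] with N hN
  have hV : (0 : ℝ) ≤ #(box d N) := Nat.cast_nonneg _
  have h1 : Real.exp (-(c₁ * #(box d N))) ≤ Real.exp (-(min c₁ c₂ * #(box d N))) := by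
    rw [Real.exp_le_exp]; nlinarith [min_le_left c₁ c₂]
  have h2 : Real.exp (-(c₂ * #(box d N))) ≤ Real.exp (-(min c₁ c₂ * #(box d N))) := by
    rw [Real.exp_le_exp]; nlinarith [min_le_right c₁ c₂]
  have hsq : Real.exp (-(min c₁ c₂ * #(box d N))) =
      Real.exp (-(min c₁ c₂ / 2 * #(box d N))) * Real.exp (-(min c₁ c₂ / 2 * #(box d N))) := by
    rw [← Real.exp_add]; congr 1; ring
  calc Real.exp (-(c₁ * #(box d N))) + Real.exp (-(c₂ * #(box d N)))
      ≤ 2 * Real.exp (-(min c₁ c₂ * #(box d N))) := by linarith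
    _ = (2 * Real.exp (-(min c₁ c₂ / 2 * #(box d N)))) * Real.exp (-(min c₁ c₂ / 2 * #(box d N))) := by
        rw [hsq]; ring
    _ ≤ 1 * Real.exp (-(min c₁ c₂ / 2 * #(box d N))) :=
        mul_le_mul_of_nonneg_right hN (Real.exp_pos _).le
    _ = _ := one_mul _

/-- The two-sided deviation event is contained in the union of the two tail events (`|Λ| > 0`). [folklore] -/
theorem setOf_le_abs_div_sub_subset {Λ : Finset (Site d)} (hΛ : Λ.Nonempty) (a ε : ℝ) :
    {σ : SpinConfig (Site d) | ε ≤ |(∑ x ∈ Λ, spinAt x σ) / #Λ - a|} ⊆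
      {σ | (a + ε) * #Λ ≤ ∑ x ∈ Λ, spinAt x σ} ∪ {σ | ∑ x ∈ Λ, spinAt x σ ≤ (a - ε) * #Λ} := by
  intro σ hσ
  have hV : (0 : ℝ) < #Λ := by exact_mod_cast hΛ.card_pos
  simp only [mem_setOf_eq, Set.mem_union] at hσ ⊢
  rcases le_abs'.1 hσ with h1 | h1
  · right
    have h2 : (∑ x ∈ Λ, spinAt x σ) / #Λ ≤ a - ε := by linarith
    rwa [div_le_iff₀ hV] at h2
  · left
    have h2 : a + ε ≤ (∑ x ∈ Λ, spinAt x σ) / #Λ := by linarith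
    rwa [le_div_iff₀ hV] at h2

/-- **EXPONENTIAL CONVERGENCE `M_N/|Λ_N| →exp ψ'(h)/β` WHERE `ψ(β,·)` IS DIFFERENTIABLE** (`d ≥ 1`, `β > 0`): if
`HasDerivAt ψ(β,·) D h` then for every `ε > 0` there is `c > 0` such that for every boundary condition, eventually
`μ^{bc}_{Λ_N;β,h}{ε ≤ |M_N/|Λ_N| − D/β|} ≤ e^{−c|Λ_N|}` — Ellis' "`S_Λ/|Λ| →exp m` iff `∂ψ/∂h` exists", the
sufficiency half, for the finite-volume Gibbs states with arbitrary boundary condition.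
[cite: Ellis2006, Thm. II.6.3 (b) ⇒ (a), Thm. IV.5.5, Thm. V.6.1 (c); Lanford1973] -/
theorem exp_concentration_of_hasDerivAt (hd : 1 ≤ d) {β : ℝ} (hβ : 0 < β) {h D : ℝ}
    (hD : HasDerivAt (fun t => pressure d β t) D h) {ε : ℝ} (hε : 0 < ε) :
    ∃ c : ℝ, 0 < c ∧ ∀ bc : BoundaryCondition (Site d), ∀ᶠ N : ℕ in atTop,
      (isingMeasure (zdGraph d) (box d N) β h bc).real
          {σ | ε ≤ |(∑ x ∈ box d N, spinAt x σ) / #(box d N) - D / β|} ≤ Real.exp (-(c * #(box d N))) := by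
  have hup : D < β * (D / β + ε) := by
    rw [mul_add, mul_div_cancel₀ _ hβ.ne']
    linarith [mul_pos hβ hε]
  have hlow : β * (D / β - ε) < D := by
    rw [mul_sub, mul_div_cancel₀ _ hβ.ne']
    linarith [mul_pos hβ hε]
  obtain ⟨c₁, hc₁, h₁⟩ := upper_tail_exp_decay_of_hasDerivWithinAt (d := d) hβ.le hD.hasDerivWithinAt hup
  obtain ⟨c₂, hc₂, h₂⟩ := lower_tail_exp_decay_of_hasDerivWithinAt (d := d) hβ.le hD.hasDerivWithinAt hlow
  refine ⟨min c₁ c₂ / 2, by positivity, fun bc => ?_⟩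
  filter_upwards [h₁ bc, h₂ bc, eventually_exp_add_exp_le hd hc₁ hc₂] with N hN₁ hN₂ hN
  exact ((measureReal_mono (setOf_le_abs_div_sub_subset (box_nonempty d N) (D / β) ε)).trans
    (measureReal_union_le _ _)).trans ((add_le_add hN₁ hN₂).trans hN)

/-- **EXPONENTIAL CONVERGENCE WHERE `ψ(β,·)` IS DIFFERENTIABLE**, `DifferentiableAt` form: `M_N/|Λ_N|` concentrates
exponentially at `deriv ψ(β,·) h / β`, for every boundary condition. [cite: Ellis2006, Thm. II.6.3, Thm. IV.5.5] -/
theorem exp_concentration_of_differentiableAt (hd : 1 ≤ d) {β : ℝ} (hβ : 0 < β) {h : ℝ}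
    (hdiff : DifferentiableAt ℝ (fun t => pressure d β t) h) {ε : ℝ} (hε : 0 < ε) :
    ∃ c : ℝ, 0 < c ∧ ∀ bc : BoundaryCondition (Site d), ∀ᶠ N : ℕ in atTop,
      (isingMeasure (zdGraph d) (box d N) β h bc).real
          {σ | ε ≤ |(∑ x ∈ box d N, spinAt x σ) / #(box d N) - deriv (fun t => pressure d β t) h / β|} ≤
        Real.exp (-(c * #(box d N))) :=
  exp_concentration_of_hasDerivAt hd hβ hdiff.hasDerivAt hε

end IsingLargeDeviations

end Summit.CriticalPhenomena.PercolationContinuityZ3.Theorems.FK
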